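import Summits.QuantumFields.BalabanUV.Beta.NVertexEvenCarrierPeriodised
import Summits.QuantumFields.BalabanUV.Beta.CompositeOneShotJetsGraded

/-!
# `BalabanUV.Beta.NVertexGradedRecordLetters` — row D1 ∕ (C1) OWNER «beta-an2», PART 93, v11 (T1) ∕ v10G: **THE N-RECORD LETTERS OF PART 13∕16∕17∕19∕21∕22 AT THE
# GRADED COMPOSITE TABLE RECORD `tabsCompG`** (PART 92: `tabsComp` with ITS `mixFF` SLOT REPLACED BY (F0)'s `compMixG`; every other slot and letter unchanged) — the
# seventeen table-dependent letters the wound even N-family's torus reading (PART 23) stands on, re-stated token for token with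
# `tabsComp (j+1) … (P.cM (j+1)) ↦ tabsCompG (j+1) … (P.cM (j+1))` and the N-system's second-order family `WN R P j := (JNat R P (j+1)).W` replaced by ITS GRADED TWIN
# written out, `WchartOf (fun _ => compChart R.rc Lc (j+1) (R.s (j+1)) (Lc^(j+1))) (tabsCompG (j+1) …) (P.cE (j+1)) (P.cVH (j+1)) (P.cΛ (j+1)) (P.cE₂ (j+1)) (P.cB (j+1)) (P.T (j+1)) 0`
# (v10's `WN` IS this term at `tabsComp` by `JNat_W` (`rfl`)); the chart `AN R j = compChart …` is UNCHANGED (its letters `decays_AN_family ∕ shiftK_AN ∕ translate_inv_AN` by name)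

WHY (journal [AN2-G84-W-2] l.69137 FINDING AN2-84-1, [AN2-G84-W-3] l.69139).  Under v11's (T1) (`hM₂′` displays the GRADED mixed table `compMixG` — the one whose pure-gauge row
closes the `a2` Ward row BY VALUE (A2-LOCATE∕ROOT) and is ONE commutator BY NAME (78b∕79c)) the road's second-order H-side chain (`TowerHN2RowMixedDoor` §2 ∕ `TowerHN2RowDoor` ∕
`TowerHN2Row`'s displayed reading `hWNff`) ends NOT in `WN`'s wound `ff` block (PART 23 at `tabsComp`, mixed words at `compMix`) but in the GRADED family's; the same reading is
what a graded re-registration of the record (v10G) or the all-rooted graded literal (O3) would consume.  This file is the LETTER layer of that graded reading: PART 13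
`WN_eq_W2SymOfK` + `tabsComp_M_apply`, PART 16 `exists_locStencil_SN ∕ SN_translate ∕ exists_locStencil₂_T2N ∕ T2N_translate ∕ exists_locStencilFM_M2N`, PART 17 `periodCov_M2N`,
PART 19 `trK_SN ∕ trK_MtN ∕ WN_evenHalf_eq`, PART 21 `WN_evenHalf_eq_W2SymOfK_zero ∕ T2N_even_apply_inl_inl`, PART 22 §1 `T2N_even_translate ∕ exists_locStencil₂_T2N_even ∕
M2N_even_translate ∕ exists_locStencilFM_M2N_even` — each at `tabsCompG`, names suffixed `…G` (`SN ↦ SNG`, `T2N ↦ T2NG`, `M2N ↦ M2NG`, `MtN ↦ MtNG`, `WN ↦ WNG`), proofs = the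
originals' character for character (the generic lit letters fed the record's FIELDS `hV hH hM hB hmix hVt hHt hMt hBt hmixt`, which `tabsCompG` carries: `hmix` PART 91, `hmixt` 79a;
`tabsComp_vh₂S ↦ tabsCompG_vh₂S`; `WN_eq, JNat_W` dropped from the one `rw` chain since the graded family is written out).  PORT BY SCRIPT from the TREE files (`gen84/rec-g84/port93.py`).

WHAT ([folklore] bookkeeping BY NAME; no `def`, no `def … : Prop`, nothing cited, 0 sorry): the seventeen letters, in dependency order.
WHAT THIS IS NOT: not a claim about which mixed table is the tower's (the (C1) second-order words decide; by value the graded one closes `a2`); not the door, not `hX′`, not the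
END; v10's PART 13–23 at `tabsComp` UNTOUCHED and still the END of record's; nothing of Bałaban's asserted, valued or discharged; 0 estimates; 0∕4 row-D1 binders (hW, hR,
D1Tel, D1Rep); ROOT M‴ p325680 ∕ P5c ∕ D6 untouched; NOT (C1), NOT (T-ID), NOT D1, NEVER «G-an2-4 closed», NOT BetaPertH, NOT continuum, NOT Clay.

HONEST DEPENDENCY (page 1, mandatory): continuum YM on T⁴ ⇐ BetaPertH ∧ nine spine estimates (0/9 proved); BetaPertH ⇐ (D1) ∧ (D4) ∧ CAP+tail;
G-an2-4 gates asym, D1 and NE2/3/4.  HONEST FRAMING (cell contract, verbatim): «discharging `BetaPertH` makes Bałaban's UV stability UNCONDITIONAL —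
a real constructive-QFT result; it is NOT the continuum limit and NOT the Clay problem.»  ABSOLUTE RULE (cell charter, verbatim): «No internally-minted
statement may enter as a cited fact. Every hypothesis is either kernel-proved in this package or a verbatim quotation of a PUBLISHED theorem with page
reference. The manuscript(s) under audit are NOT citable for their own disputed steps — they are the thing under adjudication; programme-internal
(2001/route/tribunal) claims are never citable.»  Row D1 ∕ (C1) OWNER «beta-an2», b2b-balaban-beta-an2 gen 84, 2026-08-29.  No existing file touched.
-/

noncomputable section

open scoped BigOperators

namespace Summit.QuantumFields.BalabanUV.Beta.NVertexGradedRecord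

open Finset Matrix
open Literature.MathematicalPhysics.QuantumFieldTheory
open Literature.MathematicalPhysics.QuantumFieldTheory.Balaban1983to89
open Literature.MathematicalPhysics.QuantumFieldTheory.Balaban1983to89.Beta
open Finset
open ExpKernelCalculus (MKer shiftK)
open AffineAveraging (Site box)
open OneStepResolventKernel (Fib LocStencil)
open SecondOrderResponse (dM K2OfK W2SymOfK W2OfK_apply LocStencilFM)
open WilsonBiStencil (wilsonW₂)
open BalabanStepW2 (M2Of M2Of_translate locStencilFM_M2Of)
open Summit.QuantumFields.BalabanUV.Beta.AxialDressingRooted (one_le_of_neZero)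
open Summit.QuantumFields.BalabanUV.Beta.SpineRooted (SpureRecOf T2RecOf T2RecOf_zero_level WrecOf_eq locStencil_SpureRecOf SpureRecOf_translate T2RecOf_loc T2RecOf_translate)
open Summit.QuantumFields.BalabanUV.Beta.ChartStepJets (WchartOf WchartOf_eq)
open Summit.QuantumFields.BalabanUV.Beta.CompositeCorrectorDress (compChart)
open Summit.QuantumFields.BalabanUV.Beta.CompositeOneShotJets (compH compB decays_compChart)
open Summit.QuantumFields.BalabanUV.Beta.CompositeOneShotJetData (Roots Pins JNat_W AN AN_eq WN WN_eq)
open Summit.QuantumFields.BalabanUV.Beta.FP.KernelPeriodisationFibLoc (dper)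
open B4TorusKernel.MultiPeriod (translate)
open BalabanCompositeJets (LocStencil₂)
open Summit.QuantumFields.BalabanUV.Beta.CombHId2W2SymSwap (dper_tsum_W2SymOfK_translate fmperiodCov_of_shiftK_cov)
open Summit.QuantumFields.BalabanUV.Beta.NVertexWoundPeriodised (decays_AN_family shiftK_AN)
open Summit.QuantumFields.BalabanUV.Beta.TameKernelCalculus (trK trK_apply)
open Summit.QuantumFields.BalabanUV.Beta.BorderedHessian (sgnF_inl sgnK sgnK_apply)
open Summit.QuantumFields.BalabanUV.Beta.SpineRecursiveParity (parityOdd_smul)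
open Summit.QuantumFields.BalabanUV.Beta.SecondOrderRemainderTables (abs_le_of_locStencil₂ abs_le_of_locStencilFM)
open Summit.QuantumFields.BalabanUV.Beta.CompositeTablesParity (trK_compVhS_sym trK_compHessFF_sym)
open Summit.QuantumFields.BalabanUV.Beta.SymmetrisedStepJetsParity (trK_SpureRecOf)
open Summit.QuantumFields.BalabanUV.Beta.FP.CompositeOneShotChartParity (trK_compChart)
open Summit.QuantumFields.BalabanUV.Beta.GAN24.SecondOrderCarrierParity (evenHalf_W2SymOfK locStencilFM_evenHalf)
open HessKerRate (biLoc_zero)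
open Summit.QuantumFields.BalabanUV.Beta.GAN24.BiTableParityHalves (locStencil₂_evenHalf shiftK_sgnK_trK)
open Summit.QuantumFields.BalabanUV.Beta.NVertexEvenCarrier (W2SymOfK_zero_first compB_apply_inl_inl)
open Summit.QuantumFields.BalabanUV.Beta.NVertexEvenCarrierPeriodised (dper_zero)
open Summit.QuantumFields.BalabanUV.Beta.CompositeOneShotJetsGraded (tabsCompG tabsCompG_vh₂S)

variable {d : ℕ}
variable {Lc : ℕ} [NeZero Lc] (R : Roots Lc) (P : Pins) (j : ℕ) (M : Fin (3 + 1) → ℕ) [∀ μ, NeZero (M μ)] {M' : Fin (3 + 1) → ℕ}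

/-- [folklore] the record's multiplier tables are `cM j •` the composite constraint-Hessian table (F6b `tabsOf`, `rfl`). -/
theorem tabsCompG_M_apply {r : Fin (d + 1) → ℕ} {L : ℕ} (n : ℕ) (hL : 1 ≤ L) (hr : r ∈ box (d + 1) L) (cM : ℕ → ℝ) (j : ℕ) (ρ : Fin (d + 1)) (w : Site (d + 1)) :
    (tabsCompG n hL hr cM).M j ρ w = cM j • compH r L n ρ w := rfl

/-- [folklore] **the N-system's second-order family IS an1's swap-symmetrised carrier through the N-chart over the record's slotted tables** (F6d-2 `WN_eq` ∕ F6d-1b `JNat_W` ∕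
F6d-1a `WchartOf_eq` ∕ leaf-10 `WrecOf_eq`, all `rfl`). -/
theorem WNG_eq_W2SymOfK :
    (WchartOf (fun _ => compChart R.rc Lc (j + 1) (R.s (j + 1)) (Lc ^ (j + 1))) (tabsCompG (j + 1) (one_le_of_neZero Lc) R.hr (P.cM (j + 1))) (P.cE (j + 1)) (P.cVH (j + 1)) (P.cΛ (j + 1)) (P.cE₂ (j + 1)) (P.cB (j + 1)) (P.T (j + 1)) 0) = W2SymOfK (compChart R.rc Lc (j + 1) (R.s (j + 1)) (Lc ^ (j + 1))) (Lc ^ (j + 1))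
      (SpureRecOf 3 (Lc ^ (j + 1)) (tabsCompG (j + 1) (one_le_of_neZero Lc) R.hr (P.cM (j + 1))).V (tabsCompG (j + 1) (one_le_of_neZero Lc) R.hr (P.cM (j + 1))).H
        (fun _ => compChart R.rc Lc (j + 1) (R.s (j + 1)) (Lc ^ (j + 1))) (P.cE (j + 1)) (P.cVH (j + 1)) (P.cΛ (j + 1)) 0)
      ((tabsCompG (j + 1) (one_le_of_neZero Lc) R.hr (P.cM (j + 1))).M 0)
      (T2RecOf 3 (Lc ^ (j + 1)) (fun _ => compChart R.rc Lc (j + 1) (R.s (j + 1)) (Lc ^ (j + 1)))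
        (SpureRecOf 3 (Lc ^ (j + 1)) (tabsCompG (j + 1) (one_le_of_neZero Lc) R.hr (P.cM (j + 1))).V (tabsCompG (j + 1) (one_le_of_neZero Lc) R.hr (P.cM (j + 1))).H
          (fun _ => compChart R.rc Lc (j + 1) (R.s (j + 1)) (Lc ^ (j + 1))) (P.cE (j + 1)) (P.cVH (j + 1)) (P.cΛ (j + 1)))
        (tabsCompG (j + 1) (one_le_of_neZero Lc) R.hr (P.cM (j + 1))).M (P.cE₂ (j + 1)) (P.cB (j + 1)) (P.T (j + 1))
        (tabsCompG (j + 1) (one_le_of_neZero Lc) R.hr (P.cM (j + 1))).vh₂S (tabsCompG (j + 1) (one_le_of_neZero Lc) R.hr (P.cM (j + 1))).mixFF 0)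
      (M2Of 3 (Lc ^ (j + 1)) (tabsCompG (j + 1) (one_le_of_neZero Lc) R.hr (P.cM (j + 1))).mixFF 0) := by
  rw [WchartOf_eq, WrecOf_eq]

/-- [folklore] (LS♭) every member of the N-record's pure first-order family `SpureRecOf 3 (Lc^(j+1)) V_N H_N (fun _ => AN R j) cE cVH cΛ` is a local stencil family
(`RecursiveStencilSlot.locStencil_SpureRecOf` fed the record's (LV)(LH) and (DG)). -/
theorem exists_locStencil_SNG : ∀ m : ℕ, ∃ Cs δ : ℝ, 0 < δ ∧
    LocStencil (SpureRecOf 3 (Lc ^ (j + 1)) (tabsCompG (j + 1) (one_le_of_neZero Lc) R.hr (P.cM (j + 1))).V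
      (tabsCompG (j + 1) (one_le_of_neZero Lc) R.hr (P.cM (j + 1))).H (fun _ => compChart R.rc Lc (j + 1) (R.s (j + 1)) (Lc ^ (j + 1)))
      (P.cE (j + 1)) (P.cVH (j + 1)) (P.cΛ (j + 1)) m) Cs δ :=
  locStencil_SpureRecOf (one_le_of_neZero (Lc ^ (j + 1))) (tabsCompG (j + 1) (one_le_of_neZero Lc) R.hr (P.cM (j + 1))).hV
    (tabsCompG (j + 1) (one_le_of_neZero Lc) R.hr (P.cM (j + 1))).hH (decays_AN_family R j) (P.cE (j + 1)) (P.cVH (j + 1)) (P.cΛ (j + 1))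

/-- [folklore] (St) block-translation covariance of every member of the N-record's pure first-order family (`RecursiveStencilSlot.SpureRecOf_translate` fed (TV)(TH)(TG)). -/
theorem SNG_translate : ∀ (m : ℕ) (κ' : Fin (3 + 1)) (u t : Fin (3 + 1) → ℤ),
    SpureRecOf 3 (Lc ^ (j + 1)) (tabsCompG (j + 1) (one_le_of_neZero Lc) R.hr (P.cM (j + 1))).V
        (tabsCompG (j + 1) (one_le_of_neZero Lc) R.hr (P.cM (j + 1))).H (fun _ => compChart R.rc Lc (j + 1) (R.s (j + 1)) (Lc ^ (j + 1)))
        (P.cE (j + 1)) (P.cVH (j + 1)) (P.cΛ (j + 1)) m κ' (u + ((Lc ^ (j + 1) : ℕ) : ℤ) • t)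
      = shiftK (-(((Lc ^ (j + 1) : ℕ) : ℤ) • t)) (SpureRecOf 3 (Lc ^ (j + 1)) (tabsCompG (j + 1) (one_le_of_neZero Lc) R.hr (P.cM (j + 1))).V
        (tabsCompG (j + 1) (one_le_of_neZero Lc) R.hr (P.cM (j + 1))).H (fun _ => compChart R.rc Lc (j + 1) (R.s (j + 1)) (Lc ^ (j + 1)))
        (P.cE (j + 1)) (P.cVH (j + 1)) (P.cΛ (j + 1)) m κ' u) :=
  SpureRecOf_translate (tabsCompG (j + 1) (one_le_of_neZero Lc) R.hr (P.cM (j + 1))).hVt (tabsCompG (j + 1) (one_le_of_neZero Lc) R.hr (P.cM (j + 1))).hHt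
    (shiftK_AN R j) (P.cE (j + 1)) (P.cVH (j + 1)) (P.cΛ (j + 1))

/-- [folklore] (L2) every member of the N-record's second-order field table `T2RecOf … m` is a `LocStencil₂` family (`RecursiveWSlot.T2RecOf_loc` fed (DG)(LS♭)(LM)(LB)(Lmix)). -/
theorem exists_locStencil₂_T2NG : ∀ m : ℕ, ∃ C δ : ℝ, 0 < δ ∧
    LocStencil₂ (T2RecOf 3 (Lc ^ (j + 1)) (fun _ => compChart R.rc Lc (j + 1) (R.s (j + 1)) (Lc ^ (j + 1)))
      (SpureRecOf 3 (Lc ^ (j + 1)) (tabsCompG (j + 1) (one_le_of_neZero Lc) R.hr (P.cM (j + 1))).V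
        (tabsCompG (j + 1) (one_le_of_neZero Lc) R.hr (P.cM (j + 1))).H (fun _ => compChart R.rc Lc (j + 1) (R.s (j + 1)) (Lc ^ (j + 1)))
        (P.cE (j + 1)) (P.cVH (j + 1)) (P.cΛ (j + 1)))
      (tabsCompG (j + 1) (one_le_of_neZero Lc) R.hr (P.cM (j + 1))).M (P.cE₂ (j + 1)) (P.cB (j + 1)) (P.T (j + 1))
      (tabsCompG (j + 1) (one_le_of_neZero Lc) R.hr (P.cM (j + 1))).vh₂S (tabsCompG (j + 1) (one_le_of_neZero Lc) R.hr (P.cM (j + 1))).mixFF m) C δ :=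
  T2RecOf_loc (P.cE₂ (j + 1)) (P.cB (j + 1)) (P.T (j + 1)) (tabsCompG (j + 1) (one_le_of_neZero Lc) R.hr (P.cM (j + 1))).vh₂S
    (tabsCompG (j + 1) (one_le_of_neZero Lc) R.hr (P.cM (j + 1))).mixFF (one_le_of_neZero (Lc ^ (j + 1))) (decays_AN_family R j)
    (exists_locStencil_SNG R P j) (tabsCompG (j + 1) (one_le_of_neZero Lc) R.hr (P.cM (j + 1))).hM
    (tabsCompG (j + 1) (one_le_of_neZero Lc) R.hr (P.cM (j + 1))).hB (tabsCompG (j + 1) (one_le_of_neZero Lc) R.hr (P.cM (j + 1))).hmix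

/-- [folklore] (T2t) the JOINT block covariance of every `T2RecOf … m` of the N record (`RecursiveWSlot.T2RecOf_translate` fed (TG)(St)(TM)(TB)(Tmix)). -/
theorem T2NG_translate : ∀ (m : ℕ) (κ : Fin (3 + 1)) (u : Fin (3 + 1) → ℤ) (κ' : Fin (3 + 1)) (u' t : Fin (3 + 1) → ℤ),
    T2RecOf 3 (Lc ^ (j + 1)) (fun _ => compChart R.rc Lc (j + 1) (R.s (j + 1)) (Lc ^ (j + 1)))
        (SpureRecOf 3 (Lc ^ (j + 1)) (tabsCompG (j + 1) (one_le_of_neZero Lc) R.hr (P.cM (j + 1))).V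
          (tabsCompG (j + 1) (one_le_of_neZero Lc) R.hr (P.cM (j + 1))).H (fun _ => compChart R.rc Lc (j + 1) (R.s (j + 1)) (Lc ^ (j + 1)))
          (P.cE (j + 1)) (P.cVH (j + 1)) (P.cΛ (j + 1)))
        (tabsCompG (j + 1) (one_le_of_neZero Lc) R.hr (P.cM (j + 1))).M (P.cE₂ (j + 1)) (P.cB (j + 1)) (P.T (j + 1))
        (tabsCompG (j + 1) (one_le_of_neZero Lc) R.hr (P.cM (j + 1))).vh₂S (tabsCompG (j + 1) (one_le_of_neZero Lc) R.hr (P.cM (j + 1))).mixFF m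
        κ (u + ((Lc ^ (j + 1) : ℕ) : ℤ) • t) κ' (u' + ((Lc ^ (j + 1) : ℕ) : ℤ) • t)
      = shiftK (-(((Lc ^ (j + 1) : ℕ) : ℤ) • t)) (T2RecOf 3 (Lc ^ (j + 1)) (fun _ => compChart R.rc Lc (j + 1) (R.s (j + 1)) (Lc ^ (j + 1)))
        (SpureRecOf 3 (Lc ^ (j + 1)) (tabsCompG (j + 1) (one_le_of_neZero Lc) R.hr (P.cM (j + 1))).V
          (tabsCompG (j + 1) (one_le_of_neZero Lc) R.hr (P.cM (j + 1))).H (fun _ => compChart R.rc Lc (j + 1) (R.s (j + 1)) (Lc ^ (j + 1)))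
          (P.cE (j + 1)) (P.cVH (j + 1)) (P.cΛ (j + 1)))
        (tabsCompG (j + 1) (one_le_of_neZero Lc) R.hr (P.cM (j + 1))).M (P.cE₂ (j + 1)) (P.cB (j + 1)) (P.T (j + 1))
        (tabsCompG (j + 1) (one_le_of_neZero Lc) R.hr (P.cM (j + 1))).vh₂S (tabsCompG (j + 1) (one_le_of_neZero Lc) R.hr (P.cM (j + 1))).mixFF m κ u κ' u') :=
  T2RecOf_translate (P.cE₂ (j + 1)) (P.cB (j + 1)) (P.T (j + 1)) (shiftK_AN R j) (SNG_translate R P j)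
    (tabsCompG (j + 1) (one_le_of_neZero Lc) R.hr (P.cM (j + 1))).hMt (tabsCompG (j + 1) (one_le_of_neZero Lc) R.hr (P.cM (j + 1))).hBt
    (tabsCompG (j + 1) (one_le_of_neZero Lc) R.hr (P.cM (j + 1))).hmixt

omit [NeZero Lc] in
/-- [folklore] (Lmix₂) the weighted mixed table `M2Of 3 (Lc^(j+1)) mixFF_N m` is a `LocStencilFM` family (lit `locStencilFM_M2Of` on (Lmix)). -/
theorem exists_locStencilFM_M2NG (hLc : 1 ≤ Lc) (m : ℕ) : ∃ C δ : ℝ, 0 < δ ∧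
    LocStencilFM (Lc ^ (j + 1)) (M2Of 3 (Lc ^ (j + 1)) (tabsCompG (j + 1) hLc R.hr (P.cM (j + 1))).mixFF m) C δ := by
  obtain ⟨C, δ, hδ, h⟩ := (tabsCompG (j + 1) hLc R.hr (P.cM (j + 1))).hmix
  exact ⟨_, δ, hδ, locStencilFM_M2Of h m⟩

omit [∀ μ, NeZero (M μ)] [NeZero Lc] in
/-- [folklore] the `(Tmix)` bridge at the N record: `M2Of 3 (Lc^(j+1)) mixFF_N 0` is jointly period covariant (`fmperiodCov_of_shiftK_cov` on lit `M2Of_translate (Tmix)`). -/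
theorem periodCov_M2NG (hLc : 1 ≤ Lc) (hM : ∀ i, M i = Lc ^ (j + 1) * M' i) (κ : Fin (3 + 1)) (u : Site (3 + 1)) (ρ : Fin (3 + 1)) (w m x z : Site (3 + 1)) (a c : Fib 3) :
    M2Of 3 (Lc ^ (j + 1)) (tabsCompG (j + 1) hLc R.hr (P.cM (j + 1))).mixFF 0 κ (translate M u m) ρ (translate M' w m) (translate M x m) (translate M z m) a c
      = M2Of 3 (Lc ^ (j + 1)) (tabsCompG (j + 1) hLc R.hr (P.cM (j + 1))).mixFF 0 κ u ρ w x z a c :=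
  fmperiodCov_of_shiftK_cov M hM (M2Of_translate (Lc := Lc ^ (j + 1)) (tabsCompG (j + 1) hLc R.hr (P.cM (j + 1))).hmixt 0) κ u ρ w m x z a c

/-- [folklore] **(Sp) at the N record**: every member of `S_N = SpureRecOf 3 (Lc^(j+1)) V_N H_N (fun _ => AN R j) cE cVH cΛ` is row-parity-ODD (`trK = −sgnK`)
(`SymmetrisedStepJetsParity.trK_SpureRecOf` fed (V-p) `trK_compVhS_sym`, (H-p) `trK_compHessFF_sym`, (DG) `decays_compChart`, `trK_compChart`). -/
theorem trK_SNG (m : ℕ) (κ : Fin (3 + 1)) (u : Fin (3 + 1) → ℤ) :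
    trK (SpureRecOf 3 (Lc ^ (j + 1)) (tabsCompG (j + 1) (one_le_of_neZero Lc) R.hr (P.cM (j + 1))).V
        (tabsCompG (j + 1) (one_le_of_neZero Lc) R.hr (P.cM (j + 1))).H (fun _ => compChart R.rc Lc (j + 1) (R.s (j + 1)) (Lc ^ (j + 1)))
        (P.cE (j + 1)) (P.cVH (j + 1)) (P.cΛ (j + 1)) m κ u)
      = -sgnK (SpureRecOf 3 (Lc ^ (j + 1)) (tabsCompG (j + 1) (one_le_of_neZero Lc) R.hr (P.cM (j + 1))).V
        (tabsCompG (j + 1) (one_le_of_neZero Lc) R.hr (P.cM (j + 1))).H (fun _ => compChart R.rc Lc (j + 1) (R.s (j + 1)) (Lc ^ (j + 1)))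
        (P.cE (j + 1)) (P.cVH (j + 1)) (P.cΛ (j + 1)) m κ u) :=
  trK_SpureRecOf (tabsCompG (j + 1) (one_le_of_neZero Lc) R.hr (P.cM (j + 1))).hV (tabsCompG (j + 1) (one_le_of_neZero Lc) R.hr (P.cM (j + 1))).hH (decays_AN_family R j)
    (fun _ => trK_compChart (one_le_of_neZero Lc) R.hrc (j + 1) (R.hs (j + 1)))
    (fun κ u => trK_compVhS_sym (j + 1) κ u) (fun μ y => trK_compHessFF_sym (j + 1) μ y) (P.cE (j + 1)) (P.cVH (j + 1)) (P.cΛ (j + 1)) m κ u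

/-- [folklore] **(Mp) at the N record**: the multiplier tables `tabsN.M 0 ρ w = cM • compH ρ w` are row-parity-ODD (`tabsCompG_M_apply`, (H-p)). -/
theorem trK_MtNG (ρ : Fin (3 + 1)) (w : Fin (3 + 1) → ℤ) :
    trK ((tabsCompG (j + 1) (one_le_of_neZero Lc) R.hr (P.cM (j + 1))).M 0 ρ w) = -sgnK ((tabsCompG (j + 1) (one_le_of_neZero Lc) R.hr (P.cM (j + 1))).M 0 ρ w) := by
  rw [tabsCompG_M_apply]
  exact parityOdd_smul _ (trK_compHessFF_sym (j + 1) ρ w)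

/-- [folklore] **`WNG_evenHalf_eq` — THE EVEN HALF OF THE N-SYSTEM's SECOND-ORDER FAMILY** is an1's swap-symmetrised carrier through the N-chart on the EVEN halves of
`T2_N ∕ M2_N`, MINUS its symmetrised second-response word (GAN24 `evenHalf_W2SymOfK` at the record: PART 13 `WNG_eq_W2SymOfK`, §1, F6d-1b `decays_compChart`, the bounds
from PART 16's `exists_locStencil₂_T2NG ∕ exists_locStencilFM_M2NG`). -/
theorem WNG_evenHalf_eq (μ : Fin (3 + 1)) (y : Fin (3 + 1) → ℤ) (ν : Fin (3 + 1)) (y' : Fin (3 + 1) → ℤ) :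
    (1 / 2 : ℝ) • ((WchartOf (fun _ => compChart R.rc Lc (j + 1) (R.s (j + 1)) (Lc ^ (j + 1))) (tabsCompG (j + 1) (one_le_of_neZero Lc) R.hr (P.cM (j + 1))) (P.cE (j + 1)) (P.cVH (j + 1)) (P.cΛ (j + 1)) (P.cE₂ (j + 1)) (P.cB (j + 1)) (P.T (j + 1)) 0) μ y ν y' + sgnK (trK ((WchartOf (fun _ => compChart R.rc Lc (j + 1) (R.s (j + 1)) (Lc ^ (j + 1))) (tabsCompG (j + 1) (one_le_of_neZero Lc) R.hr (P.cM (j + 1))) (P.cE (j + 1)) (P.cVH (j + 1)) (P.cΛ (j + 1)) (P.cE₂ (j + 1)) (P.cB (j + 1)) (P.T (j + 1)) 0) μ y ν y')))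
      = W2SymOfK (compChart R.rc Lc (j + 1) (R.s (j + 1)) (Lc ^ (j + 1))) (Lc ^ (j + 1))
          (SpureRecOf 3 (Lc ^ (j + 1)) (tabsCompG (j + 1) (one_le_of_neZero Lc) R.hr (P.cM (j + 1))).V
        (tabsCompG (j + 1) (one_le_of_neZero Lc) R.hr (P.cM (j + 1))).H (fun _ => compChart R.rc Lc (j + 1) (R.s (j + 1)) (Lc ^ (j + 1)))
        (P.cE (j + 1)) (P.cVH (j + 1)) (P.cΛ (j + 1)) 0) ((tabsCompG (j + 1) (one_le_of_neZero Lc) R.hr (P.cM (j + 1))).M 0)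
          (fun κ u κ' u' => (1 / 2 : ℝ) • (T2RecOf 3 (Lc ^ (j + 1)) (fun _ => compChart R.rc Lc (j + 1) (R.s (j + 1)) (Lc ^ (j + 1)))
        (SpureRecOf 3 (Lc ^ (j + 1)) (tabsCompG (j + 1) (one_le_of_neZero Lc) R.hr (P.cM (j + 1))).V
        (tabsCompG (j + 1) (one_le_of_neZero Lc) R.hr (P.cM (j + 1))).H (fun _ => compChart R.rc Lc (j + 1) (R.s (j + 1)) (Lc ^ (j + 1)))
        (P.cE (j + 1)) (P.cVH (j + 1)) (P.cΛ (j + 1)))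
        (tabsCompG (j + 1) (one_le_of_neZero Lc) R.hr (P.cM (j + 1))).M (P.cE₂ (j + 1)) (P.cB (j + 1)) (P.T (j + 1))
        (tabsCompG (j + 1) (one_le_of_neZero Lc) R.hr (P.cM (j + 1))).vh₂S (tabsCompG (j + 1) (one_le_of_neZero Lc) R.hr (P.cM (j + 1))).mixFF 0 κ u κ' u'
          + sgnK (trK (T2RecOf 3 (Lc ^ (j + 1)) (fun _ => compChart R.rc Lc (j + 1) (R.s (j + 1)) (Lc ^ (j + 1)))
        (SpureRecOf 3 (Lc ^ (j + 1)) (tabsCompG (j + 1) (one_le_of_neZero Lc) R.hr (P.cM (j + 1))).V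
        (tabsCompG (j + 1) (one_le_of_neZero Lc) R.hr (P.cM (j + 1))).H (fun _ => compChart R.rc Lc (j + 1) (R.s (j + 1)) (Lc ^ (j + 1)))
        (P.cE (j + 1)) (P.cVH (j + 1)) (P.cΛ (j + 1)))
        (tabsCompG (j + 1) (one_le_of_neZero Lc) R.hr (P.cM (j + 1))).M (P.cE₂ (j + 1)) (P.cB (j + 1)) (P.T (j + 1))
        (tabsCompG (j + 1) (one_le_of_neZero Lc) R.hr (P.cM (j + 1))).vh₂S (tabsCompG (j + 1) (one_le_of_neZero Lc) R.hr (P.cM (j + 1))).mixFF 0 κ u κ' u'))))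
          (fun κ u ρ w => (1 / 2 : ℝ) • (M2Of 3 (Lc ^ (j + 1)) (tabsCompG (j + 1) (one_le_of_neZero Lc) R.hr (P.cM (j + 1))).mixFF 0 κ u ρ w + sgnK (trK (M2Of 3 (Lc ^ (j + 1)) (tabsCompG (j + 1) (one_le_of_neZero Lc) R.hr (P.cM (j + 1))).mixFF 0 κ u ρ w)))) μ y ν y'
        - (1 / 2 : ℝ) • (dM (K2OfK (compChart R.rc Lc (j + 1) (R.s (j + 1)) (Lc ^ (j + 1))) (Lc ^ (j + 1)) (SpureRecOf 3 (Lc ^ (j + 1)) (tabsCompG (j + 1) (one_le_of_neZero Lc) R.hr (P.cM (j + 1))).V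
        (tabsCompG (j + 1) (one_le_of_neZero Lc) R.hr (P.cM (j + 1))).H (fun _ => compChart R.rc Lc (j + 1) (R.s (j + 1)) (Lc ^ (j + 1)))
        (P.cE (j + 1)) (P.cVH (j + 1)) (P.cΛ (j + 1)) 0) ((tabsCompG (j + 1) (one_le_of_neZero Lc) R.hr (P.cM (j + 1))).M 0) ν y') (Lc ^ (j + 1))
          (SpureRecOf 3 (Lc ^ (j + 1)) (tabsCompG (j + 1) (one_le_of_neZero Lc) R.hr (P.cM (j + 1))).V
        (tabsCompG (j + 1) (one_le_of_neZero Lc) R.hr (P.cM (j + 1))).H (fun _ => compChart R.rc Lc (j + 1) (R.s (j + 1)) (Lc ^ (j + 1)))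
        (P.cE (j + 1)) (P.cVH (j + 1)) (P.cΛ (j + 1)) 0) ((tabsCompG (j + 1) (one_le_of_neZero Lc) R.hr (P.cM (j + 1))).M 0) μ y
          + dM (K2OfK (compChart R.rc Lc (j + 1) (R.s (j + 1)) (Lc ^ (j + 1))) (Lc ^ (j + 1)) (SpureRecOf 3 (Lc ^ (j + 1)) (tabsCompG (j + 1) (one_le_of_neZero Lc) R.hr (P.cM (j + 1))).V
        (tabsCompG (j + 1) (one_le_of_neZero Lc) R.hr (P.cM (j + 1))).H (fun _ => compChart R.rc Lc (j + 1) (R.s (j + 1)) (Lc ^ (j + 1)))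
        (P.cE (j + 1)) (P.cVH (j + 1)) (P.cΛ (j + 1)) 0) ((tabsCompG (j + 1) (one_le_of_neZero Lc) R.hr (P.cM (j + 1))).M 0) μ y) (Lc ^ (j + 1))
          (SpureRecOf 3 (Lc ^ (j + 1)) (tabsCompG (j + 1) (one_le_of_neZero Lc) R.hr (P.cM (j + 1))).V
        (tabsCompG (j + 1) (one_le_of_neZero Lc) R.hr (P.cM (j + 1))).H (fun _ => compChart R.rc Lc (j + 1) (R.s (j + 1)) (Lc ^ (j + 1)))
        (P.cE (j + 1)) (P.cVH (j + 1)) (P.cΛ (j + 1)) 0) ((tabsCompG (j + 1) (one_le_of_neZero Lc) R.hr (P.cM (j + 1))).M 0) ν y') := by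
  obtain ⟨C₂, δ₂, hδ₂, hT₂⟩ := exists_locStencil₂_T2NG R P j 0
  obtain ⟨Cm, δm, hδm, hM₂⟩ := exists_locStencilFM_M2NG R P j (one_le_of_neZero Lc) 0
  rw [WNG_eq_W2SymOfK]
  exact evenHalf_W2SymOfK (N := Lc ^ (j + 1)) (decays_compChart (one_le_of_neZero Lc) R.hrc (j + 1) (R.hs (j + 1))) (trK_SNG R P j 0) (trK_MtNG R P j)
    (fun κ u κ' u' x z a b => abs_le_of_locStencil₂ hT₂ hδ₂.le κ u κ' u' x z a b)
    (fun κ u ρ w x z a b => abs_le_of_locStencilFM hM₂ hδm.le κ u ρ w x z a b) μ y ν y'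

/-- [folklore] **`WNG_evenHalf_eq_W2SymOfK_zero` — THE EVEN HALF OF THE N-SYSTEM's SECOND-ORDER FAMILY IS an1's SYMMETRISED CARRIER THROUGH THE N-CHART AT ZERO
FIRST-ORDER TABLES OVER THE EVEN HALVES `T2_Nᵉ ∕ M2_Nᵉ`** (PART 19 `WNG_evenHalf_eq`; the response words inside and outside `W2SymOfK` cancel — lit `W2OfK_apply`, §1). -/
theorem WNG_evenHalf_eq_W2SymOfK_zero (μ : Fin (3 + 1)) (y : Fin (3 + 1) → ℤ) (ν : Fin (3 + 1)) (y' : Fin (3 + 1) → ℤ) :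
    (1 / 2 : ℝ) • ((WchartOf (fun _ => compChart R.rc Lc (j + 1) (R.s (j + 1)) (Lc ^ (j + 1))) (tabsCompG (j + 1) (one_le_of_neZero Lc) R.hr (P.cM (j + 1))) (P.cE (j + 1)) (P.cVH (j + 1)) (P.cΛ (j + 1)) (P.cE₂ (j + 1)) (P.cB (j + 1)) (P.T (j + 1)) 0) μ y ν y' + sgnK (trK ((WchartOf (fun _ => compChart R.rc Lc (j + 1) (R.s (j + 1)) (Lc ^ (j + 1))) (tabsCompG (j + 1) (one_le_of_neZero Lc) R.hr (P.cM (j + 1))) (P.cE (j + 1)) (P.cVH (j + 1)) (P.cΛ (j + 1)) (P.cE₂ (j + 1)) (P.cB (j + 1)) (P.T (j + 1)) 0) μ y ν y')))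
      = W2SymOfK (AN R j) (Lc ^ (j + 1)) (0 : Fin (3 + 1) → (Fin (3 + 1) → ℤ) → MKer (3 + 1) (Fib 3)) (0 : Fin (3 + 1) → (Fin (3 + 1) → ℤ) → MKer (3 + 1) (Fib 3))
          (fun κ u κ' u' => (1 / 2 : ℝ) • (T2RecOf 3 (Lc ^ (j + 1)) (fun _ => compChart R.rc Lc (j + 1) (R.s (j + 1)) (Lc ^ (j + 1)))
        (SpureRecOf 3 (Lc ^ (j + 1)) (tabsCompG (j + 1) (one_le_of_neZero Lc) R.hr (P.cM (j + 1))).V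
        (tabsCompG (j + 1) (one_le_of_neZero Lc) R.hr (P.cM (j + 1))).H (fun _ => compChart R.rc Lc (j + 1) (R.s (j + 1)) (Lc ^ (j + 1)))
        (P.cE (j + 1)) (P.cVH (j + 1)) (P.cΛ (j + 1)))
        (tabsCompG (j + 1) (one_le_of_neZero Lc) R.hr (P.cM (j + 1))).M (P.cE₂ (j + 1)) (P.cB (j + 1)) (P.T (j + 1))
        (tabsCompG (j + 1) (one_le_of_neZero Lc) R.hr (P.cM (j + 1))).vh₂S (tabsCompG (j + 1) (one_le_of_neZero Lc) R.hr (P.cM (j + 1))).mixFF 0 κ u κ' u'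
          + sgnK (trK (T2RecOf 3 (Lc ^ (j + 1)) (fun _ => compChart R.rc Lc (j + 1) (R.s (j + 1)) (Lc ^ (j + 1)))
        (SpureRecOf 3 (Lc ^ (j + 1)) (tabsCompG (j + 1) (one_le_of_neZero Lc) R.hr (P.cM (j + 1))).V
        (tabsCompG (j + 1) (one_le_of_neZero Lc) R.hr (P.cM (j + 1))).H (fun _ => compChart R.rc Lc (j + 1) (R.s (j + 1)) (Lc ^ (j + 1)))
        (P.cE (j + 1)) (P.cVH (j + 1)) (P.cΛ (j + 1)))
        (tabsCompG (j + 1) (one_le_of_neZero Lc) R.hr (P.cM (j + 1))).M (P.cE₂ (j + 1)) (P.cB (j + 1)) (P.T (j + 1))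
        (tabsCompG (j + 1) (one_le_of_neZero Lc) R.hr (P.cM (j + 1))).vh₂S (tabsCompG (j + 1) (one_le_of_neZero Lc) R.hr (P.cM (j + 1))).mixFF 0 κ u κ' u'))))
          (fun κ u ρ w => (1 / 2 : ℝ) • (M2Of 3 (Lc ^ (j + 1)) (tabsCompG (j + 1) (one_le_of_neZero Lc) R.hr (P.cM (j + 1))).mixFF 0 κ u ρ w + sgnK (trK (M2Of 3 (Lc ^ (j + 1)) (tabsCompG (j + 1) (one_le_of_neZero Lc) R.hr (P.cM (j + 1))).mixFF 0 κ u ρ w)))) μ y ν y' := by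
  rw [WNG_evenHalf_eq R P j μ y ν y', AN_eq, W2SymOfK_zero_first]
  unfold W2SymOfK
  rw [W2OfK_apply, W2OfK_apply]
  funext x z a b
  simp only [Pi.add_apply, Pi.sub_apply, Pi.smul_apply, smul_eq_mul]
  ring

/-- [folklore] **the even half of `T2_N` on `(inl, inl)` is `cE₂ ·` the even half of the Wilson bi-stencil** (`T2RecOf_zero_level`: `T2_N = cE₂•wilsonW₂ + cB•compB`; `compB|ff = 0` in
both orientations). -/
theorem T2NG_even_apply_inl_inl (κ : Fin (3 + 1)) (u : Fin (3 + 1) → ℤ) (κ' : Fin (3 + 1)) (u' x z : Fin (3 + 1) → ℤ) (α β : Fin (3 + 1)) :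
    ((1 / 2 : ℝ) • (T2RecOf 3 (Lc ^ (j + 1)) (fun _ => compChart R.rc Lc (j + 1) (R.s (j + 1)) (Lc ^ (j + 1)))
        (SpureRecOf 3 (Lc ^ (j + 1)) (tabsCompG (j + 1) (one_le_of_neZero Lc) R.hr (P.cM (j + 1))).V
        (tabsCompG (j + 1) (one_le_of_neZero Lc) R.hr (P.cM (j + 1))).H (fun _ => compChart R.rc Lc (j + 1) (R.s (j + 1)) (Lc ^ (j + 1)))
        (P.cE (j + 1)) (P.cVH (j + 1)) (P.cΛ (j + 1)))
        (tabsCompG (j + 1) (one_le_of_neZero Lc) R.hr (P.cM (j + 1))).M (P.cE₂ (j + 1)) (P.cB (j + 1)) (P.T (j + 1))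
        (tabsCompG (j + 1) (one_le_of_neZero Lc) R.hr (P.cM (j + 1))).vh₂S (tabsCompG (j + 1) (one_le_of_neZero Lc) R.hr (P.cM (j + 1))).mixFF 0 κ u κ' u'
          + sgnK (trK (T2RecOf 3 (Lc ^ (j + 1)) (fun _ => compChart R.rc Lc (j + 1) (R.s (j + 1)) (Lc ^ (j + 1)))
        (SpureRecOf 3 (Lc ^ (j + 1)) (tabsCompG (j + 1) (one_le_of_neZero Lc) R.hr (P.cM (j + 1))).V
        (tabsCompG (j + 1) (one_le_of_neZero Lc) R.hr (P.cM (j + 1))).H (fun _ => compChart R.rc Lc (j + 1) (R.s (j + 1)) (Lc ^ (j + 1)))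
        (P.cE (j + 1)) (P.cVH (j + 1)) (P.cΛ (j + 1)))
        (tabsCompG (j + 1) (one_le_of_neZero Lc) R.hr (P.cM (j + 1))).M (P.cE₂ (j + 1)) (P.cB (j + 1)) (P.T (j + 1))
        (tabsCompG (j + 1) (one_le_of_neZero Lc) R.hr (P.cM (j + 1))).vh₂S (tabsCompG (j + 1) (one_le_of_neZero Lc) R.hr (P.cM (j + 1))).mixFF 0 κ u κ' u')))) x z (Sum.inl α) (Sum.inl β)
      = P.cE₂ (j + 1) * ((1 / 2 : ℝ) • (wilsonW₂ 3 (P.T (j + 1)) κ u κ' u' + sgnK (trK (wilsonW₂ 3 (P.T (j + 1)) κ u κ' u')))) x z (Sum.inl α) (Sum.inl β) := by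
  simp only [T2RecOf_zero_level, tabsCompG_vh₂S, Pi.smul_apply, Pi.add_apply, smul_eq_mul, sgnK_apply, trK_apply, sgnF_inl, compB_apply_inl_inl]
  ring

/-- [folklore] (T2ᵉt) the JOINT block covariance of the EVEN half of `T2_N` (PART 16 `T2NG_translate` + GAN24 `shiftK_sgnK_trK`; `shiftK` commutes with `•`, `+` by `rfl`). -/
theorem T2NG_even_translate (κ : Fin (3 + 1)) (u : Fin (3 + 1) → ℤ) (κ' : Fin (3 + 1)) (u' t : Fin (3 + 1) → ℤ) :
    ((1 / 2 : ℝ) • (T2RecOf 3 (Lc ^ (j + 1)) (fun _ => compChart R.rc Lc (j + 1) (R.s (j + 1)) (Lc ^ (j + 1)))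
        (SpureRecOf 3 (Lc ^ (j + 1)) (tabsCompG (j + 1) (one_le_of_neZero Lc) R.hr (P.cM (j + 1))).V
        (tabsCompG (j + 1) (one_le_of_neZero Lc) R.hr (P.cM (j + 1))).H (fun _ => compChart R.rc Lc (j + 1) (R.s (j + 1)) (Lc ^ (j + 1)))
        (P.cE (j + 1)) (P.cVH (j + 1)) (P.cΛ (j + 1)))
        (tabsCompG (j + 1) (one_le_of_neZero Lc) R.hr (P.cM (j + 1))).M (P.cE₂ (j + 1)) (P.cB (j + 1)) (P.T (j + 1))
        (tabsCompG (j + 1) (one_le_of_neZero Lc) R.hr (P.cM (j + 1))).vh₂S (tabsCompG (j + 1) (one_le_of_neZero Lc) R.hr (P.cM (j + 1))).mixFF 0 κ (u + ((Lc ^ (j + 1) : ℕ) : ℤ) • t) κ' (u' + ((Lc ^ (j + 1) : ℕ) : ℤ) • t)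
          + sgnK (trK (T2RecOf 3 (Lc ^ (j + 1)) (fun _ => compChart R.rc Lc (j + 1) (R.s (j + 1)) (Lc ^ (j + 1)))
        (SpureRecOf 3 (Lc ^ (j + 1)) (tabsCompG (j + 1) (one_le_of_neZero Lc) R.hr (P.cM (j + 1))).V
        (tabsCompG (j + 1) (one_le_of_neZero Lc) R.hr (P.cM (j + 1))).H (fun _ => compChart R.rc Lc (j + 1) (R.s (j + 1)) (Lc ^ (j + 1)))
        (P.cE (j + 1)) (P.cVH (j + 1)) (P.cΛ (j + 1)))
        (tabsCompG (j + 1) (one_le_of_neZero Lc) R.hr (P.cM (j + 1))).M (P.cE₂ (j + 1)) (P.cB (j + 1)) (P.T (j + 1))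
        (tabsCompG (j + 1) (one_le_of_neZero Lc) R.hr (P.cM (j + 1))).vh₂S (tabsCompG (j + 1) (one_le_of_neZero Lc) R.hr (P.cM (j + 1))).mixFF 0 κ (u + ((Lc ^ (j + 1) : ℕ) : ℤ) • t) κ' (u' + ((Lc ^ (j + 1) : ℕ) : ℤ) • t)))))
      = shiftK (-(((Lc ^ (j + 1) : ℕ) : ℤ) • t)) ((1 / 2 : ℝ) • (T2RecOf 3 (Lc ^ (j + 1)) (fun _ => compChart R.rc Lc (j + 1) (R.s (j + 1)) (Lc ^ (j + 1)))
        (SpureRecOf 3 (Lc ^ (j + 1)) (tabsCompG (j + 1) (one_le_of_neZero Lc) R.hr (P.cM (j + 1))).V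
        (tabsCompG (j + 1) (one_le_of_neZero Lc) R.hr (P.cM (j + 1))).H (fun _ => compChart R.rc Lc (j + 1) (R.s (j + 1)) (Lc ^ (j + 1)))
        (P.cE (j + 1)) (P.cVH (j + 1)) (P.cΛ (j + 1)))
        (tabsCompG (j + 1) (one_le_of_neZero Lc) R.hr (P.cM (j + 1))).M (P.cE₂ (j + 1)) (P.cB (j + 1)) (P.T (j + 1))
        (tabsCompG (j + 1) (one_le_of_neZero Lc) R.hr (P.cM (j + 1))).vh₂S (tabsCompG (j + 1) (one_le_of_neZero Lc) R.hr (P.cM (j + 1))).mixFF 0 κ u κ' u'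
          + sgnK (trK (T2RecOf 3 (Lc ^ (j + 1)) (fun _ => compChart R.rc Lc (j + 1) (R.s (j + 1)) (Lc ^ (j + 1)))
        (SpureRecOf 3 (Lc ^ (j + 1)) (tabsCompG (j + 1) (one_le_of_neZero Lc) R.hr (P.cM (j + 1))).V
        (tabsCompG (j + 1) (one_le_of_neZero Lc) R.hr (P.cM (j + 1))).H (fun _ => compChart R.rc Lc (j + 1) (R.s (j + 1)) (Lc ^ (j + 1)))
        (P.cE (j + 1)) (P.cVH (j + 1)) (P.cΛ (j + 1)))
        (tabsCompG (j + 1) (one_le_of_neZero Lc) R.hr (P.cM (j + 1))).M (P.cE₂ (j + 1)) (P.cB (j + 1)) (P.T (j + 1))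
        (tabsCompG (j + 1) (one_le_of_neZero Lc) R.hr (P.cM (j + 1))).vh₂S (tabsCompG (j + 1) (one_le_of_neZero Lc) R.hr (P.cM (j + 1))).mixFF 0 κ u κ' u')))) := by
  rw [T2NG_translate R P j 0 κ u κ' u' t, ← shiftK_sgnK_trK]
  rfl

/-- [folklore] (L2ᵉ) the EVEN half of `T2_N` is a `LocStencil₂` family (PART 16 `exists_locStencil₂_T2NG` + GAN24 `locStencil₂_evenHalf`, same constants). -/
theorem exists_locStencil₂_T2NG_even : ∃ C δ : ℝ, 0 < δ ∧ LocStencil₂ (fun κ u κ' u' => ((1 / 2 : ℝ) • (T2RecOf 3 (Lc ^ (j + 1)) (fun _ => compChart R.rc Lc (j + 1) (R.s (j + 1)) (Lc ^ (j + 1)))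
        (SpureRecOf 3 (Lc ^ (j + 1)) (tabsCompG (j + 1) (one_le_of_neZero Lc) R.hr (P.cM (j + 1))).V
        (tabsCompG (j + 1) (one_le_of_neZero Lc) R.hr (P.cM (j + 1))).H (fun _ => compChart R.rc Lc (j + 1) (R.s (j + 1)) (Lc ^ (j + 1)))
        (P.cE (j + 1)) (P.cVH (j + 1)) (P.cΛ (j + 1)))
        (tabsCompG (j + 1) (one_le_of_neZero Lc) R.hr (P.cM (j + 1))).M (P.cE₂ (j + 1)) (P.cB (j + 1)) (P.T (j + 1))
        (tabsCompG (j + 1) (one_le_of_neZero Lc) R.hr (P.cM (j + 1))).vh₂S (tabsCompG (j + 1) (one_le_of_neZero Lc) R.hr (P.cM (j + 1))).mixFF 0 κ u κ' u'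
          + sgnK (trK (T2RecOf 3 (Lc ^ (j + 1)) (fun _ => compChart R.rc Lc (j + 1) (R.s (j + 1)) (Lc ^ (j + 1)))
        (SpureRecOf 3 (Lc ^ (j + 1)) (tabsCompG (j + 1) (one_le_of_neZero Lc) R.hr (P.cM (j + 1))).V
        (tabsCompG (j + 1) (one_le_of_neZero Lc) R.hr (P.cM (j + 1))).H (fun _ => compChart R.rc Lc (j + 1) (R.s (j + 1)) (Lc ^ (j + 1)))
        (P.cE (j + 1)) (P.cVH (j + 1)) (P.cΛ (j + 1)))
        (tabsCompG (j + 1) (one_le_of_neZero Lc) R.hr (P.cM (j + 1))).M (P.cE₂ (j + 1)) (P.cB (j + 1)) (P.T (j + 1))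
        (tabsCompG (j + 1) (one_le_of_neZero Lc) R.hr (P.cM (j + 1))).vh₂S (tabsCompG (j + 1) (one_le_of_neZero Lc) R.hr (P.cM (j + 1))).mixFF 0 κ u κ' u'))))) C δ := by
  obtain ⟨C, δ, hδ, h⟩ := exists_locStencil₂_T2NG R P j 0
  exact ⟨C, δ, hδ, locStencil₂_evenHalf h⟩

/-- [folklore] (M2ᵉt) the JOINT covariance (fine block shift ∕ coarse shift) of the EVEN half of `M2_N` (lit `M2Of_translate` on the record's (Tmix) + GAN24 `shiftK_sgnK_trK`). -/
theorem M2NG_even_translate (κ : Fin (3 + 1)) (u : Fin (3 + 1) → ℤ) (ρ : Fin (3 + 1)) (w t : Fin (3 + 1) → ℤ) :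
    ((1 / 2 : ℝ) • (M2Of 3 (Lc ^ (j + 1)) (tabsCompG (j + 1) (one_le_of_neZero Lc) R.hr (P.cM (j + 1))).mixFF 0 κ (u + ((Lc ^ (j + 1) : ℕ) : ℤ) • t) ρ (w + t) + sgnK (trK (M2Of 3 (Lc ^ (j + 1)) (tabsCompG (j + 1) (one_le_of_neZero Lc) R.hr (P.cM (j + 1))).mixFF 0 κ (u + ((Lc ^ (j + 1) : ℕ) : ℤ) • t) ρ (w + t)))))
      = shiftK (-(((Lc ^ (j + 1) : ℕ) : ℤ) • t)) ((1 / 2 : ℝ) • (M2Of 3 (Lc ^ (j + 1)) (tabsCompG (j + 1) (one_le_of_neZero Lc) R.hr (P.cM (j + 1))).mixFF 0 κ u ρ w + sgnK (trK (M2Of 3 (Lc ^ (j + 1)) (tabsCompG (j + 1) (one_le_of_neZero Lc) R.hr (P.cM (j + 1))).mixFF 0 κ u ρ w)))) := by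
  rw [M2Of_translate (Lc := Lc ^ (j + 1)) ((tabsCompG (j + 1) (one_le_of_neZero Lc) R.hr (P.cM (j + 1))).hmixt) 0 κ u ρ w t, ← shiftK_sgnK_trK]
  rfl

omit [NeZero Lc] in
/-- [folklore] (Lmix₂ᵉ) the EVEN half of `M2_N` is a `LocStencilFM` family (PART 16 `exists_locStencilFM_M2NG` + GAN24 `locStencilFM_evenHalf`). -/
theorem exists_locStencilFM_M2NG_even (hLc : 1 ≤ Lc) : ∃ C δ : ℝ, 0 < δ ∧
    LocStencilFM (Lc ^ (j + 1)) (fun κ u ρ w => (1 / 2 : ℝ) • (M2Of 3 (Lc ^ (j + 1)) (tabsCompG (j + 1) hLc R.hr (P.cM (j + 1))).mixFF 0 κ u ρ w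
      + sgnK (trK (M2Of 3 (Lc ^ (j + 1)) (tabsCompG (j + 1) hLc R.hr (P.cM (j + 1))).mixFF 0 κ u ρ w)))) C δ := by
  obtain ⟨C, δ, hδ, h⟩ := exists_locStencilFM_M2NG R P j hLc 0
  exact ⟨C, δ, hδ, locStencilFM_evenHalf h⟩

/-- [folklore] **`dper_tsum_WNG_evenHalf` — THE WOUND EVEN N-FAMILY, COPY-SUMMED IN THE SECOND BOND AND PERIODISED, IS an1's CARRIER AT ZERO FIRST-ORDER TABLES OVER THE
PERIODISED EVEN TABLES** (`M = Lc^(j+1)·M′`):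
`dper M (x z a c ↦ Σ'_n WN♮ μ y ν (translate M′ y′ n) x z a c) = W2SymOfK (AN R j) (Lc^(j+1)) 0 0 T2_Nᵉ^{per,csf} M2_Nᵉ^{per,cs} μ y ν y′`
— PART 21 `WNG_evenHalf_eq_W2SymOfK_zero` termwise, then `CombHId2W2SymSwap.dper_tsum_W2SymOfK_translate` with §1's letters and the trivial zero-table sockets. -/
theorem dper_tsum_WNG_evenHalf (hM : ∀ i, M i = Lc ^ (j + 1) * M' i) (μ : Fin (3 + 1)) (y : Site (3 + 1)) (ν : Fin (3 + 1)) (y' : Site (3 + 1)) :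
    dper M (fun x z a c => ∑' n : Site (3 + 1), ((1 / 2 : ℝ) • ((WchartOf (fun _ => compChart R.rc Lc (j + 1) (R.s (j + 1)) (Lc ^ (j + 1))) (tabsCompG (j + 1) (one_le_of_neZero Lc) R.hr (P.cM (j + 1))) (P.cE (j + 1)) (P.cVH (j + 1)) (P.cΛ (j + 1)) (P.cE₂ (j + 1)) (P.cB (j + 1)) (P.T (j + 1)) 0) μ y ν (translate M' y' n) + sgnK (trK ((WchartOf (fun _ => compChart R.rc Lc (j + 1) (R.s (j + 1)) (Lc ^ (j + 1))) (tabsCompG (j + 1) (one_le_of_neZero Lc) R.hr (P.cM (j + 1))) (P.cE (j + 1)) (P.cVH (j + 1)) (P.cΛ (j + 1)) (P.cE₂ (j + 1)) (P.cB (j + 1)) (P.T (j + 1)) 0) μ y ν (translate M' y' n))))) x z a c)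
      = W2SymOfK (AN R j) (Lc ^ (j + 1)) (0 : Fin (3 + 1) → (Fin (3 + 1) → ℤ) → MKer (3 + 1) (Fib 3)) (0 : Fin (3 + 1) → (Fin (3 + 1) → ℤ) → MKer (3 + 1) (Fib 3))
          (fun κ u κ' u' => dper M (fun x z a c => ∑' n : Site (3 + 1),
            ((1 / 2 : ℝ) • (T2RecOf 3 (Lc ^ (j + 1)) (fun _ => compChart R.rc Lc (j + 1) (R.s (j + 1)) (Lc ^ (j + 1)))
        (SpureRecOf 3 (Lc ^ (j + 1)) (tabsCompG (j + 1) (one_le_of_neZero Lc) R.hr (P.cM (j + 1))).V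
        (tabsCompG (j + 1) (one_le_of_neZero Lc) R.hr (P.cM (j + 1))).H (fun _ => compChart R.rc Lc (j + 1) (R.s (j + 1)) (Lc ^ (j + 1)))
        (P.cE (j + 1)) (P.cVH (j + 1)) (P.cΛ (j + 1)))
        (tabsCompG (j + 1) (one_le_of_neZero Lc) R.hr (P.cM (j + 1))).M (P.cE₂ (j + 1)) (P.cB (j + 1)) (P.T (j + 1))
        (tabsCompG (j + 1) (one_le_of_neZero Lc) R.hr (P.cM (j + 1))).vh₂S (tabsCompG (j + 1) (one_le_of_neZero Lc) R.hr (P.cM (j + 1))).mixFF 0 κ u κ' (translate M u' n)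
          + sgnK (trK (T2RecOf 3 (Lc ^ (j + 1)) (fun _ => compChart R.rc Lc (j + 1) (R.s (j + 1)) (Lc ^ (j + 1)))
        (SpureRecOf 3 (Lc ^ (j + 1)) (tabsCompG (j + 1) (one_le_of_neZero Lc) R.hr (P.cM (j + 1))).V
        (tabsCompG (j + 1) (one_le_of_neZero Lc) R.hr (P.cM (j + 1))).H (fun _ => compChart R.rc Lc (j + 1) (R.s (j + 1)) (Lc ^ (j + 1)))
        (P.cE (j + 1)) (P.cVH (j + 1)) (P.cΛ (j + 1)))
        (tabsCompG (j + 1) (one_le_of_neZero Lc) R.hr (P.cM (j + 1))).M (P.cE₂ (j + 1)) (P.cB (j + 1)) (P.T (j + 1))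
        (tabsCompG (j + 1) (one_le_of_neZero Lc) R.hr (P.cM (j + 1))).vh₂S (tabsCompG (j + 1) (one_le_of_neZero Lc) R.hr (P.cM (j + 1))).mixFF 0 κ u κ' (translate M u' n))))) x z a c))
          (fun κ u ρ w => dper M (fun x z a c => ∑' n : Site (3 + 1),
            ((1 / 2 : ℝ) • (M2Of 3 (Lc ^ (j + 1)) (tabsCompG (j + 1) (one_le_of_neZero Lc) R.hr (P.cM (j + 1))).mixFF 0 κ u ρ (translate M' w n) + sgnK (trK (M2Of 3 (Lc ^ (j + 1)) (tabsCompG (j + 1) (one_le_of_neZero Lc) R.hr (P.cM (j + 1))).mixFF 0 κ u ρ (translate M' w n))))) x z a c)) μ y ν y' := by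
  obtain ⟨δG, CG, hδG, hCG, hG⟩ := decays_AN_family R j 0
  obtain ⟨C₂, δ₂, hδ₂, hS₂⟩ := exists_locStencil₂_T2NG_even R P j
  obtain ⟨Cm, δm, hδm, hM₂⟩ := exists_locStencilFM_M2NG_even R P j (one_le_of_neZero Lc)
  have e : (fun x z a c => ∑' n : Site (3 + 1), ((1 / 2 : ℝ) • ((WchartOf (fun _ => compChart R.rc Lc (j + 1) (R.s (j + 1)) (Lc ^ (j + 1))) (tabsCompG (j + 1) (one_le_of_neZero Lc) R.hr (P.cM (j + 1))) (P.cE (j + 1)) (P.cVH (j + 1)) (P.cΛ (j + 1)) (P.cE₂ (j + 1)) (P.cB (j + 1)) (P.T (j + 1)) 0) μ y ν (translate M' y' n) + sgnK (trK ((WchartOf (fun _ => compChart R.rc Lc (j + 1) (R.s (j + 1)) (Lc ^ (j + 1))) (tabsCompG (j + 1) (one_le_of_neZero Lc) R.hr (P.cM (j + 1))) (P.cE (j + 1)) (P.cVH (j + 1)) (P.cΛ (j + 1)) (P.cE₂ (j + 1)) (P.cB (j + 1)) (P.T (j + 1)) 0) μ y ν (translate M' y' n))))) x z a c)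
      = fun x z a c => ∑' n : Site (3 + 1), W2SymOfK (compChart R.rc Lc (j + 1) (R.s (j + 1)) (Lc ^ (j + 1))) (Lc ^ (j + 1)) (0 : Fin (3 + 1) → (Fin (3 + 1) → ℤ) → MKer (3 + 1) (Fib 3)) (0 : Fin (3 + 1) → (Fin (3 + 1) → ℤ) → MKer (3 + 1) (Fib 3))
          (fun κ u κ' u' => ((1 / 2 : ℝ) • (T2RecOf 3 (Lc ^ (j + 1)) (fun _ => compChart R.rc Lc (j + 1) (R.s (j + 1)) (Lc ^ (j + 1)))
        (SpureRecOf 3 (Lc ^ (j + 1)) (tabsCompG (j + 1) (one_le_of_neZero Lc) R.hr (P.cM (j + 1))).V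
        (tabsCompG (j + 1) (one_le_of_neZero Lc) R.hr (P.cM (j + 1))).H (fun _ => compChart R.rc Lc (j + 1) (R.s (j + 1)) (Lc ^ (j + 1)))
        (P.cE (j + 1)) (P.cVH (j + 1)) (P.cΛ (j + 1)))
        (tabsCompG (j + 1) (one_le_of_neZero Lc) R.hr (P.cM (j + 1))).M (P.cE₂ (j + 1)) (P.cB (j + 1)) (P.T (j + 1))
        (tabsCompG (j + 1) (one_le_of_neZero Lc) R.hr (P.cM (j + 1))).vh₂S (tabsCompG (j + 1) (one_le_of_neZero Lc) R.hr (P.cM (j + 1))).mixFF 0 κ u κ' u'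
          + sgnK (trK (T2RecOf 3 (Lc ^ (j + 1)) (fun _ => compChart R.rc Lc (j + 1) (R.s (j + 1)) (Lc ^ (j + 1)))
        (SpureRecOf 3 (Lc ^ (j + 1)) (tabsCompG (j + 1) (one_le_of_neZero Lc) R.hr (P.cM (j + 1))).V
        (tabsCompG (j + 1) (one_le_of_neZero Lc) R.hr (P.cM (j + 1))).H (fun _ => compChart R.rc Lc (j + 1) (R.s (j + 1)) (Lc ^ (j + 1)))
        (P.cE (j + 1)) (P.cVH (j + 1)) (P.cΛ (j + 1)))
        (tabsCompG (j + 1) (one_le_of_neZero Lc) R.hr (P.cM (j + 1))).M (P.cE₂ (j + 1)) (P.cB (j + 1)) (P.T (j + 1))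
        (tabsCompG (j + 1) (one_le_of_neZero Lc) R.hr (P.cM (j + 1))).vh₂S (tabsCompG (j + 1) (one_le_of_neZero Lc) R.hr (P.cM (j + 1))).mixFF 0 κ u κ' u')))))
          (fun κ u ρ w => ((1 / 2 : ℝ) • (M2Of 3 (Lc ^ (j + 1)) (tabsCompG (j + 1) (one_le_of_neZero Lc) R.hr (P.cM (j + 1))).mixFF 0 κ u ρ w + sgnK (trK (M2Of 3 (Lc ^ (j + 1)) (tabsCompG (j + 1) (one_le_of_neZero Lc) R.hr (P.cM (j + 1))).mixFF 0 κ u ρ w))))) μ y ν (translate M' y' n) x z a c := by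
    funext x z a c
    exact tsum_congr fun n => by rw [WNG_evenHalf_eq_W2SymOfK_zero R P j μ y ν (translate M' y' n), AN_eq]
  have h := dper_tsum_W2SymOfK_translate M hM (shiftK_AN R j 0) hG hCG hδG
    (S := (0 : Fin (3 + 1) → (Fin (3 + 1) → ℤ) → MKer (3 + 1) (Fib 3))) (fun _ _ _ => rfl) (fun κ u => biLoc_zero _ _ (1 : ℝ)) one_pos
    (Mt := (0 : Fin (3 + 1) → (Fin (3 + 1) → ℤ) → MKer (3 + 1) (Fib 3))) (fun _ _ _ => rfl) (fun ρ w => biLoc_zero _ _ (1 : ℝ)) one_pos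
    (T2NG_even_translate R P j) hS₂ hδ₂ (M2NG_even_translate R P j) hM₂ hδm μ y ν y'
  rw [e, h, AN_eq]
  simp only [Pi.zero_apply, dper_zero]
  rfl

omit [∀ μ, NeZero (M μ)] [NeZero Lc] in
/-- [folklore] the EVEN half of `M2_N` is jointly period covariant (fine block shift of the field bond and of the kernel arguments, coarse shift of the multiplier bond) —
PART 17 `periodCov_M2NG` on both terms. -/
theorem periodCov_M2NG_even (hLc : 1 ≤ Lc) (hM : ∀ i, M i = Lc ^ (j + 1) * M' i) (κ : Fin (3 + 1)) (u : Site (3 + 1)) (ρ : Fin (3 + 1)) (w m x z : Site (3 + 1)) (a c : Fib 3) :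
    ((1 / 2 : ℝ) • (M2Of 3 (Lc ^ (j + 1)) (tabsCompG (j + 1) hLc R.hr (P.cM (j + 1))).mixFF 0 κ (translate M u m) ρ (translate M' w m)
        + sgnK (trK (M2Of 3 (Lc ^ (j + 1)) (tabsCompG (j + 1) hLc R.hr (P.cM (j + 1))).mixFF 0 κ (translate M u m) ρ (translate M' w m)))))
        (translate M x m) (translate M z m) a c
      = ((1 / 2 : ℝ) • (M2Of 3 (Lc ^ (j + 1)) (tabsCompG (j + 1) hLc R.hr (P.cM (j + 1))).mixFF 0 κ u ρ w
        + sgnK (trK (M2Of 3 (Lc ^ (j + 1)) (tabsCompG (j + 1) hLc R.hr (P.cM (j + 1))).mixFF 0 κ u ρ w)))) x z a c := by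
  simp only [Pi.smul_apply, Pi.add_apply, smul_eq_mul, sgnK_apply, trK_apply]
  rw [periodCov_M2NG R P j M hLc hM, periodCov_M2NG R P j M hLc hM]

end Summit.QuantumFields.BalabanUV.Beta.NVertexGradedRecord
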